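import Summits.SmoothPoincare4.SmoothPoincare4.Theses.WeakReductionDescent

/-!
# `DependentTripleAtThree` — the exact price of the minimality hypothesis: modulo `LowGenusBase`, dropping it costs precisely `W3` (dependent triples in genus-3 trisections of the STANDARD sphere)

Negative lane of crux `WeakReductionDescent.DependentTripleAtThree` (item stmt-SmoothPoincare4-17999),
§4 of the crux workfile `Cruxes/DependentTripleAtThree/Disproof.lean` (seat
refuter-cdisprove-stmt-SmoothPoincare4-17999-0, 2026-08-17).  Load-bearing analysis of the MINIMALITY
hypothesis `∀ g' k' T', IsGKTrisection M g' k' T' → 3 ≤ g'` of the crux.  Write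

* `WithoutMinimality` := the crux with that hypothesis deleted (every genus-3 GK-trisection of every
  smooth homotopy 4-sphere admits a dependent triple), and
* `W3` := every genus-3 GK-trisection of a smooth 4-manifold DIFFEOMORPHIC to `S⁴` admits a dependent
  triple — the genus-3 dependent-triple shadow of the 4-dimensional Waldhausen conjecture (Aranda–Zupan
  arXiv:2503.04607 p. 27: "whether every trisection of S⁴ is a(n unbalanced) stabilization of the
  genus-zero trisection"), a statement about the standard sphere alone;

both inlined below (no new definitions; the `let`-block is the crux's conclusion verbatim).  Then,
sorry-free and by pure logic over the route's own decls:

* `w3_of_withoutMinimality` — `WithoutMinimality → W3` (a diffeomorphism is a homotopy equivalence);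
* `withoutMinimality_of_dependentTripleAtThree_of_w3` — `LowGenusBase → DependentTripleAtThree → W3 →
  WithoutMinimality` (a NON-minimal genus-3 trisection sits on an `M` carrying a trisection of genus
  `≤ 2`, so `M ≅ S⁴` by the route's support `LowGenusBase` = MSZ16/MZ17, and `W3` applies);
* `withoutMinimality_iff_dependentTripleAtThree_and_w3` — hence, modulo `LowGenusBase`,
  `WithoutMinimality ↔ DependentTripleAtThree ∧ W3`.

READING.  Minimality is load-bearing for the crux IFF `W3` FAILS, i.e. iff the standard `S⁴` carries a
genus-3 GK-trisection without dependent triple — a sub-question of AZ25 Question 8.3 (p. 27 L23–31,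
candidates: lifts of 4-bridge trisections of odd-twist-spun 2-bridge knots, `≅ S⁴`) that no exotic
phenomenon touches and no bounded curve search can refute (absence of a dependent triple is not
finitely certifiable); conversely every dependent triple FOUND in such a diagram confirms an instance
of `W3`.  Neither outcome moves the crux itself, which is SPC4-shielded
(`Negative/OfSmoothPoincare4.lean`).  No statement here concludes a route item.
-/

noncomputable section

-- the registered namespace `Summit.SmoothPoincare4.SmoothPoincare4.Theorems` repeats a component
set_option linter.dupNamespace false

open scoped Manifold ContDiff Topology ContinuousMap
open Set Literature.Topology.FourManifolds
open Summit.SmoothPoincare4.SmoothPoincare4.Theses.WeakReductionDescent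

namespace Summit.SmoothPoincare4.SmoothPoincare4.Theorems.DependentTripleAtThree.Negative

/-- **`WithoutMinimality → W3`**: the crux without its minimality hypothesis already asserts a
dependent triple in every genus-3 GK-trisection of every `M ≅ S⁴` (transport `Φ` to a homotopy
equivalence). [folklore] -/
theorem w3_of_withoutMinimality
    (h : (∀ (M : Type) [TopologicalSpace M] [T2Space M] [SecondCountableTopology M]
        [ChartedSpace (EuclideanSpace ℝ (Fin 4)) M] [IsManifold (𝓡 4) ∞ M],
        (M ≃ₕ (Metric.sphere (0 : EuclideanSpace ℝ (Fin 5)) 1)) →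
        ∀ (k : Fin 3 → ℕ) (T : Fin 3 → Set M), IsGKTrisection M 3 k T →
        (let F : Set M := ⋂ l, T l; let H : Fin 3 → Set M := fun p => ⋂ (l : Fin 3) (_ : l ≠ p), T l; let IsCurve : Set M → Prop := fun c => c ⊆ F ∧ ∃ γ : (Metric.sphere (0 : EuclideanSpace ℝ (Fin 2)) 1) → M, Manifold.IsSmoothEmbedding (𝓡 1) (𝓡 4) ((⊤ : ℕ∞) : WithTop ℕ∞) γ ∧ Set.range γ = c; let BoundsDisc : Set M → Set M → Prop := fun A c => ∃ d : (Metric.closedBall (0 : EuclideanSpace ℝ (Fin 2)) 1) → M, Manifold.IsSmoothEmbedding (𝓡∂ 2) (𝓡 4) ((⊤ : ℕ∞) : WithTop ℕ∞) d ∧ Set.range d ⊆ A ∧ d '' ((𝓡∂ 2).boundary (Metric.closedBall (0 : EuclideanSpace ℝ (Fin 2)) 1)) = c ∧ Set.range d ∩ F = c; let NonSep : Set M → Prop := fun c => IsConnected (F \ c); let DependentTriple : Prop := ∃ (a b c : Set M), IsCurve a ∧ IsCurve b ∧ IsCurve c ∧ Disjoint a b ∧ Disjoint b c ∧ Disjoint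 a c ∧ NonSep a ∧ NonSep b ∧ NonSep c ∧ BoundsDisc (H 0) a ∧ BoundsDisc (H 1) b ∧ BoundsDisc (H 2) c ∧ ¬ IsPreconnected (F \ (a ∪ b ∪ c)); DependentTriple))) :
    (∀ (M : Type) [TopologicalSpace M] [T2Space M] [SecondCountableTopology M]
        [ChartedSpace (EuclideanSpace ℝ (Fin 4)) M] [IsManifold (𝓡 4) ∞ M],
        Nonempty (M ≃ₘ⟮𝓡 4, 𝓡 4⟯ (Metric.sphere (0 : EuclideanSpace ℝ (Fin 5)) 1)) →
        ∀ (k : Fin 3 → ℕ) (T : Fin 3 → Set M), IsGKTrisection M 3 k T →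
        (let F : Set M := ⋂ l, T l; let H : Fin 3 → Set M := fun p => ⋂ (l : Fin 3) (_ : l ≠ p), T l; let IsCurve : Set M → Prop := fun c => c ⊆ F ∧ ∃ γ : (Metric.sphere (0 : EuclideanSpace ℝ (Fin 2)) 1) → M, Manifold.IsSmoothEmbedding (𝓡 1) (𝓡 4) ((⊤ : ℕ∞) : WithTop ℕ∞) γ ∧ Set.range γ = c; let BoundsDisc : Set M → Set M → Prop := fun A c => ∃ d : (Metric.closedBall (0 : EuclideanSpace ℝ (Fin 2)) 1) → M, Manifold.IsSmoothEmbedding (𝓡∂ 2) (𝓡 4) ((⊤ : ℕ∞) : WithTop ℕ∞) d ∧ Set.range d ⊆ A ∧ d '' ((𝓡∂ 2).boundary (Metric.closedBall (0 : EuclideanSpace ℝ (Fin 2)) 1)) = c ∧ Set.range d ∩ F = c; let NonSep : Set M → Prop := fun c => IsConnected (F \ c); let DependentTriple : Prop := ∃ (a b c : Set M), IsCurve a ∧ IsCurve b ∧ IsCurve c ∧ Disjoint a b ∧ Disjoint b c ∧ Disjoint a c ∧ NonSep a ∧ NonSep b ∧ NonSep c ∧ BoundsDisc (H 0) a ∧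 BoundsDisc (H 1) b ∧ BoundsDisc (H 2) c ∧ ¬ IsPreconnected (F \ (a ∪ b ∪ c)); DependentTriple)) := by
  intro M _ _ _ _ _ hΦ k T hT
  obtain ⟨Φ⟩ := hΦ
  exact h M Φ.toHomeomorph.toHomotopyEquiv k T hT

/-- **`LowGenusBase → DependentTripleAtThree → W3 → WithoutMinimality`**: a genus-3 GK-trisection of
a smooth homotopy 4-sphere is either minimal — the crux's case — or `M` has a trisection of genus
`≤ 2`, whence `M ≅ S⁴` (`LowGenusBase`, MSZ16/MZ17) and `W3` applies. [folklore] -/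
theorem withoutMinimality_of_dependentTripleAtThree_of_w3 (hL : LowGenusBase)
    (h1 : DependentTripleAtThree)
    (h3 : (∀ (M : Type) [TopologicalSpace M] [T2Space M] [SecondCountableTopology M]
        [ChartedSpace (EuclideanSpace ℝ (Fin 4)) M] [IsManifold (𝓡 4) ∞ M],
        Nonempty (M ≃ₘ⟮𝓡 4, 𝓡 4⟯ (Metric.sphere (0 : EuclideanSpace ℝ (Fin 5)) 1)) →
        ∀ (k : Fin 3 → ℕ) (T : Fin 3 → Set M), IsGKTrisection M 3 k T →
        (let F : Set M := ⋂ l, T l; let H : Fin 3 → Set M := fun p => ⋂ (l : Fin 3) (_ : l ≠ p), T l; let IsCurve : Set M → Prop := fun c => c ⊆ F ∧ ∃ γ : (Metric.sphere (0 : EuclideanSpace ℝ (Fin 2)) 1) → M, Manifold.IsSmoothEmbedding (𝓡 1) (𝓡 4) ((⊤ : ℕ∞) : WithTop ℕ∞) γ ∧ Set.range γ = c; let BoundsDisc : Set M → Set M → Prop := fun A c => ∃ d : (Metric.closedBall (0 : EuclideanSpace ℝ (Fin 2)) 1) → M, Manifold.IsSmoothEmbedding (𝓡∂ 2) (𝓡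 4) ((⊤ : ℕ∞) : WithTop ℕ∞) d ∧ Set.range d ⊆ A ∧ d '' ((𝓡∂ 2).boundary (Metric.closedBall (0 : EuclideanSpace ℝ (Fin 2)) 1)) = c ∧ Set.range d ∩ F = c; let NonSep : Set M → Prop := fun c => IsConnected (F \ c); let DependentTriple : Prop := ∃ (a b c : Set M), IsCurve a ∧ IsCurve b ∧ IsCurve c ∧ Disjoint a b ∧ Disjoint b c ∧ Disjoint a c ∧ NonSep a ∧ NonSep b ∧ NonSep c ∧ BoundsDisc (H 0) a ∧ BoundsDisc (H 1) b ∧ BoundsDisc (H 2) c ∧ ¬ IsPreconnected (F \ (a ∪ b ∪ c)); DependentTriple))) :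
    (∀ (M : Type) [TopologicalSpace M] [T2Space M] [SecondCountableTopology M]
        [ChartedSpace (EuclideanSpace ℝ (Fin 4)) M] [IsManifold (𝓡 4) ∞ M],
        (M ≃ₕ (Metric.sphere (0 : EuclideanSpace ℝ (Fin 5)) 1)) →
        ∀ (k : Fin 3 → ℕ) (T : Fin 3 → Set M), IsGKTrisection M 3 k T →
        (let F : Set M := ⋂ l, T l; let H : Fin 3 → Set M := fun p => ⋂ (l : Fin 3) (_ : l ≠ p), T l; let IsCurve : Set M → Prop := fun c => c ⊆ F ∧ ∃ γ : (Metric.sphere (0 : EuclideanSpace ℝ (Fin 2)) 1) → M, Manifold.IsSmoothEmbedding (𝓡 1) (𝓡 4) ((⊤ : ℕ∞) : WithTop ℕ∞) γ ∧ Set.range γ = c; let BoundsDisc : Set M → Set M → Prop := fun A c => ∃ d : (Metric.closedBall (0 : EuclideanSpace ℝ (Fin 2)) 1) → M, Manifold.IsSmoothEmbedding (𝓡∂ 2) (𝓡 4) ((⊤ : ℕ∞) : WithTop ℕ∞) d ∧ Set.range d ⊆ A ∧ d '' ((𝓡∂ 2).boundary (Metric.closedBall (0 : EuclideanSpace ℝ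 (Fin 2)) 1)) = c ∧ Set.range d ∩ F = c; let NonSep : Set M → Prop := fun c => IsConnected (F \ c); let DependentTriple : Prop := ∃ (a b c : Set M), IsCurve a ∧ IsCurve b ∧ IsCurve c ∧ Disjoint a b ∧ Disjoint b c ∧ Disjoint a c ∧ NonSep a ∧ NonSep b ∧ NonSep c ∧ BoundsDisc (H 0) a ∧ BoundsDisc (H 1) b ∧ BoundsDisc (H 2) c ∧ ¬ IsPreconnected (F \ (a ∪ b ∪ c)); DependentTriple)) := by
  intro M _ _ _ _ _ e k T hT
  by_cases hmin : ∀ (g' : ℕ) (k' : Fin 3 → ℕ) (T' : Fin 3 → Set M), IsGKTrisection M g' k' T' → 3 ≤ g'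
  · exact h1 M e k T hT hmin
  · push Not at hmin
    obtain ⟨g', k', T', hT', hlt⟩ := hmin
    exact h3 M (hL M e g' k' T' hT' (by omega)) k T hT

/-- **The exact price of minimality** (modulo `LowGenusBase`):
`WithoutMinimality ↔ DependentTripleAtThree ∧ W3` — minimality is load-bearing iff `W3` fails, i.e.
iff the STANDARD `S⁴` has a genus-3 GK-trisection with no dependent triple. [folklore] -/
theorem withoutMinimality_iff_dependentTripleAtThree_and_w3 (hL : LowGenusBase) :
    (∀ (M : Type) [TopologicalSpace M] [T2Space M] [SecondCountableTopology M]
        [ChartedSpace (EuclideanSpace ℝ (Fin 4)) M] [IsManifold (𝓡 4) ∞ M],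
        (M ≃ₕ (Metric.sphere (0 : EuclideanSpace ℝ (Fin 5)) 1)) →
        ∀ (k : Fin 3 → ℕ) (T : Fin 3 → Set M), IsGKTrisection M 3 k T →
        (let F : Set M := ⋂ l, T l; let H : Fin 3 → Set M := fun p => ⋂ (l : Fin 3) (_ : l ≠ p), T l; let IsCurve : Set M → Prop := fun c => c ⊆ F ∧ ∃ γ : (Metric.sphere (0 : EuclideanSpace ℝ (Fin 2)) 1) → M, Manifold.IsSmoothEmbedding (𝓡 1) (𝓡 4) ((⊤ : ℕ∞) : WithTop ℕ∞) γ ∧ Set.range γ = c; let BoundsDisc : Set M → Set M → Prop := fun A c => ∃ d : (Metric.closedBall (0 : EuclideanSpace ℝ (Fin 2)) 1) → M, Manifold.IsSmoothEmbedding (𝓡∂ 2) (𝓡 4) ((⊤ : ℕ∞) : WithTop ℕ∞) d ∧ Set.range d ⊆ A ∧ d '' ((𝓡∂ 2).boundary (Metric.closedBall (0 : EuclideanSpace ℝ (Fin 2)) 1)) = c ∧ Set.range d ∩ F = c; let NonSep : Set M → Prop := fun c => IsConnected (F \ c); let DependentTriple : Prop := ∃ (a b c : Set M), IsCurve a ∧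 IsCurve b ∧ IsCurve c ∧ Disjoint a b ∧ Disjoint b c ∧ Disjoint a c ∧ NonSep a ∧ NonSep b ∧ NonSep c ∧ BoundsDisc (H 0) a ∧ BoundsDisc (H 1) b ∧ BoundsDisc (H 2) c ∧ ¬ IsPreconnected (F \ (a ∪ b ∪ c)); DependentTriple)) ↔
    (DependentTripleAtThree ∧
      (∀ (M : Type) [TopologicalSpace M] [T2Space M] [SecondCountableTopology M]
        [ChartedSpace (EuclideanSpace ℝ (Fin 4)) M] [IsManifold (𝓡 4) ∞ M],
        Nonempty (M ≃ₘ⟮𝓡 4, 𝓡 4⟯ (Metric.sphere (0 : EuclideanSpace ℝ (Fin 5)) 1)) →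
        ∀ (k : Fin 3 → ℕ) (T : Fin 3 → Set M), IsGKTrisection M 3 k T →
        (let F : Set M := ⋂ l, T l; let H : Fin 3 → Set M := fun p => ⋂ (l : Fin 3) (_ : l ≠ p), T l; let IsCurve : Set M → Prop := fun c => c ⊆ F ∧ ∃ γ : (Metric.sphere (0 : EuclideanSpace ℝ (Fin 2)) 1) → M, Manifold.IsSmoothEmbedding (𝓡 1) (𝓡 4) ((⊤ : ℕ∞) : WithTop ℕ∞) γ ∧ Set.range γ = c; let BoundsDisc : Set M → Set M → Prop := fun A c => ∃ d : (Metric.closedBall (0 : EuclideanSpace ℝ (Fin 2)) 1) → M, Manifold.IsSmoothEmbedding (𝓡∂ 2) (𝓡 4) ((⊤ : ℕ∞) : WithTop ℕ∞) d ∧ Set.range d ⊆ A ∧ d '' ((𝓡∂ 2).boundary (Metric.closedBall (0 : EuclideanSpace ℝ (Fin 2)) 1)) = c ∧ Set.range d ∩ F = c; let NonSep : Set M → Prop := fun c => IsConnected (F \ c); let DependentTriple : Prop := ∃ (a b c : Set M), IsCurve a ∧ IsCurve b ∧ IsCurve c ∧ Disjoint a b ∧ Disjoint b c ∧ Disjoint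 a c ∧ NonSep a ∧ NonSep b ∧ NonSep c ∧ BoundsDisc (H 0) a ∧ BoundsDisc (H 1) b ∧ BoundsDisc (H 2) c ∧ ¬ IsPreconnected (F \ (a ∪ b ∪ c)); DependentTriple))) :=
  ⟨fun h => ⟨fun M _ _ _ _ _ e k T hT _ => h M e k T hT, w3_of_withoutMinimality h⟩,
    fun h => withoutMinimality_of_dependentTripleAtThree_of_w3 hL h.1 h.2⟩

end Summit.SmoothPoincare4.SmoothPoincare4.Theorems.DependentTripleAtThree.Negative

end
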